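import Mathlib
import Summits.Ventures.PercRepro.PuncturedLYMUnif46Count
import Summits.Ventures.PercRepro.PuncturedLYMUnif46PosMain1
import Summits.Ventures.PercRepro.PuncturedLYMUnif46Rows
import Summits.Ventures.PercRepro.PuncturedLYMUnif46Cols

/-!
# PercRepro — (SP) FOR ANY NUMBER OF PAIRWISE DISJOINT `4`-SETS AT LEVEL `6` ON EVERY GROUND SET (THEOREM)
(p10, gen 40)

THE THEOREM `puncturedNMP_allk_4_6`: for every finite type `α`, every `k` and every `k` pairwise disjoint `4`-subsets `C i`,
the punctured normalised matching property (SP) holds at level `6` for the rows avoiding all members — no hypothesis on the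
number of points or on `k`.  For `n ≤ 6` points there is no `7`-set; for `n ≥ 7` the flow is the class-symmetric potential
flow of PuncturedLYMUnif46Table: a row type `a : Fin k → ℕ` (values `≤ 3`) has the class `(cnt 1 a, …, cnt 3 a)`, the weight
towards a point of the member `i` is `wdir` at the direction `a i`, towards a free point at the direction `4`, all divided by
`#Y`; the row identities (…Rows) and the column identities (…Cols) are the type equations, the sums over the `k` members are
grouped by value (`sum_eq_cnt`), the lift of PuncturedLYMTypeLift turns the table into a flow with row sums `1/#P` and column
sums `1/#Y`, and gen 36's bridge gives (SP).
-/

namespace PercRepro.PuncturedLYM.Split.TypeLift.Unif46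

open Finset

/-! ### The weight function -/

/-- The weight of a row class towards a direction `v` (`v < 3`: a point of a member met in `v` points; `3`: the last point of a
member met in `3` points, a member column; `4`: a free point), guarded by the class being realised by a row of an instance
`(n, k)` with `n ≥ 7`. -/
def wdir (n : ℚ) (k : ℕ) (c1 c2 c3 v : ℕ) : ℚ :=
  if v = 3 then 1 / 4 else
  if 7 ≤ n ∧ 4 * (k : ℚ) ≤ n ∧ (c1 : ℚ) + c2 + c3 ≤ k ∧ (6 : ℚ) - c1 - 2 * c2 - 3 * c3 ≤ n - 4 * k then raw n k c1 c2 c3 v else 0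

/-- The weights are nonnegative. -/
theorem wdir_nonneg (n : ℚ) (k c1 c2 c3 v : ℕ) : 0 ≤ wdir n k c1 c2 c3 v := by
  unfold wdir
  split_ifs with h1 h2
  · norm_num
  · obtain ⟨hn, hk3, hk, hf⟩ := h2
    exact raw_nonneg n k c1 c2 c3 v hn hk3 (nat_cast_cases_two k) hk hf
  · exact le_refl 0

/-- Under the guard the weight is the table entry. -/
theorem wdir_eq_raw (n : ℚ) (k c1 c2 c3 v : ℕ) (hv : v ≠ 3) (hn : 7 ≤ n) (hk3 : 4 * (k : ℚ) ≤ n)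
    (hk : (c1 : ℚ) + c2 + c3 ≤ k) (hf : (6 : ℚ) - c1 - 2 * c2 - 3 * c3 ≤ n - 4 * k) : wdir n k c1 c2 c3 v = raw n k c1 c2 c3 v := by
  unfold wdir
  rw [if_neg hv, if_pos ⟨hn, hk3, hk, hf⟩]

/-- The member-column weight is `1/4`. -/
theorem wdir_top (n : ℚ) (k c1 c2 c3 : ℕ) : wdir n k c1 c2 c3 3 = 1 / 4 := by
  unfold wdir
  rw [if_pos rfl]

/-- The weight function of the lift: the class of the row type and the direction, normalised by `#Y`. -/
def W (n : ℚ) (k : ℕ) (a : Fin k → ℕ) (_c : ℕ) (d : Option (Fin k)) : ℚ :=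
  (d.elim (wdir n k (cnt 1 a) (cnt 2 a) (cnt 3 a) 4) (fun i => wdir n k (cnt 1 a) (cnt 2 a) (cnt 3 a) (a i))) / Yc n

/-- `W` at a free direction. -/
theorem W_none (n : ℚ) (k : ℕ) (a : Fin k → ℕ) (c : ℕ) :
    W n k a c none = wdir n k (cnt 1 a) (cnt 2 a) (cnt 3 a) 4 / Yc n :=
  rfl

/-- `W` at a member direction. -/
theorem W_some (n : ℚ) (k : ℕ) (a : Fin k → ℕ) (c : ℕ) (i : Fin k) :
    W n k a c (some i) = wdir n k (cnt 1 a) (cnt 2 a) (cnt 3 a) (a i) / Yc n :=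
  rfl

/-- `W` is nonnegative (`n ≥ 7`). -/
theorem W_nonneg (n : ℚ) (hn : 7 ≤ n) (k : ℕ) (a : Fin k → ℕ) (c : ℕ) (d : Option (Fin k)) : 0 ≤ W n k a c d := by
  have hY := (Yc_pos n hn).le
  cases d
  · rw [W_none]; exact div_nonneg (wdir_nonneg _ _ _ _ _ _) hY
  · rw [W_some]; exact div_nonneg (wdir_nonneg _ _ _ _ _ _) hY

section Main

variable {α : Type} [DecidableEq α] [Fintype α] {k : ℕ}

/-- Two of the members' up-levels are disjoint: a `6`-set contains at most one `4`-member. -/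
theorem disjoint_upLevel_mem (C : Fin k → Finset α) (hcard : ∀ i, (C i).card = 4)
    (hdisj : ∀ i l, i ≠ l → Disjoint (C i) (C l)) (i l : Fin k) (hil : i ≠ l) :
    Disjoint (upLevel 6 (C i)) (upLevel 6 (C l)) := by
  rw [disjoint_left]
  intro X h1 h2
  rw [mem_upLevel] at h1 h2
  have := card_le_card (union_subset h1.2 h2.2)
  rw [card_union_of_disjoint (hdisj i l hil), hcard, hcard, h1.1] at this
  omega

/-- The members occupy `4k` of the `n` points. -/
theorem mem_mul_le_card (C : Fin k → Finset α) (hcard : ∀ i, (C i).card = 4)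
    (hdisj : ∀ i l, i ≠ l → Disjoint (C i) (C l)) : 4 * k ≤ Fintype.card α := by
  have h := card_le_univ ((univ : Finset (Fin k)).biUnion C)
  rw [card_biUnion (fun i _ l _ hil => hdisj i l hil)] at h
  simp only [hcard, sum_const, card_univ, Fintype.card_fin, smul_eq_mul] at h
  linarith

/-- `#P = C(n, 6) − k C(n − 4, 2) = Pc n k` for `n = m' + 7`. -/
theorem card_punctured_unif (m' : ℕ) (hn : Fintype.card α = m' + 7) (C : Fin k → Finset α)
    (hcard : ∀ i, (C i).card = 4) (hdisj : ∀ i l, i ≠ l → Disjoint (C i) (C l)) :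
    (((punctured 6 ((univ : Finset (Fin k)).biUnion (fun i => upLevel 6 (C i)))).card : ℕ) : ℚ) =
      Pc ((m' : ℚ) + 7) k := by
  unfold punctured
  have hsub : (univ : Finset (Fin k)).biUnion (fun i => upLevel 6 (C i)) ⊆ (univ : Finset α).powersetCard 6 := by
    intro X hX
    obtain ⟨i, _, hXi⟩ := mem_biUnion.1 hX
    rw [mem_powersetCard]
    exact ⟨subset_univ X, (mem_upLevel.1 hXi).1⟩
  have hu : ∀ i, (upLevel 6 (C i)).card = (m' + 3).choose 2 := by
    intro i
    rw [card_upLevel (by have := hcard i; omega), hcard, hn, show m' + 7 - 4 = m' + 3 by omega]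
  have hD : ((univ : Finset (Fin k)).biUnion (fun i => upLevel 6 (C i))).card = k * (m' + 3).choose 2 := by
    rw [card_biUnion (fun i _ l _ hil => disjoint_upLevel_mem C hcard hdisj i l hil)]
    simp only [hu, sum_const, card_univ, Fintype.card_fin, smul_eq_mul]
  rw [card_sdiff_of_subset hsub, card_powersetCard, card_univ, hn, hD]
  have hle : k * (m' + 3).choose 2 ≤ (m' + 7).choose 6 := by
    have := card_le_card hsub
    rw [card_powersetCard, card_univ, hn, hD] at this
    exact this
  rw [Nat.cast_sub hle, choose_l_cast]
  push_cast
  rw [choose_lm_cast]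
  unfold Pc
  ring

omit [DecidableEq α] in
/-- `#Y = C(n, 7) = Yc n` for `n = m' + 7`. -/
theorem card_levelAbove_unif (m' : ℕ) (hn : Fintype.card α = m' + 7) :
    (((levelAbove α 6).card : ℕ) : ℚ) = Yc ((m' : ℚ) + 7) := by
  unfold levelAbove
  rw [card_powersetCard, card_univ, hn, choose_l1_cast]
  unfold Yc
  ring


/-! ### The theorem for `n ≥ 7` -/

/-- **THEOREM. (SP) for `k` pairwise disjoint `4`-sets at level `6` on a ground set with `n ≥ 7` points**, by the symbolic
type certificate in `(n, k)`. -/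
theorem puncturedNMP_unif_of_le (m' : ℕ) (hn : Fintype.card α = m' + 7) (C : Fin k → Finset α)
    (hcard : ∀ i, (C i).card = 4) (hdisj : ∀ i l, i ≠ l → Disjoint (C i) (C l)) :
    PuncturedNMP 6 ((univ : Finset (Fin k)).biUnion (fun i => upLevel 6 (C i))) := by
  apply puncturedNMP_of_hasFlow
  rw [card_punctured_unif m' hn C hcard hdisj, card_levelAbove_unif m' hn]
  set n : ℚ := (m' : ℚ) + 7 with hn_def
  have hn5 : (7 : ℚ) ≤ n := by rw [hn_def]; linarith [(Nat.cast_nonneg m' : (0 : ℚ) ≤ m')]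
  have hk3 : 4 * (k : ℚ) ≤ n := by
    have := mem_mul_le_card C hcard hdisj
    rw [hn] at this
    rw [hn_def]
    exact_mod_cast this
  have hQ := (Qp_pos n k hn5 (nat_cast_cases_two k) hk3).ne'
  have hP := (Pp_pos n k hn5 hk3).ne'
  have hPc := (Pc_pos n k hn5 hk3).ne'
  have hY := (Yc_pos n hn5).ne'
  have hbig : ∀ i l, i ≠ l → 6 + 2 ≤ (C i).card + (C l).card := by
    intro i l _
    have := hcard i
    have := hcard l
    omega
  have hfree : (freeSet C).card = m' + 7 - 4 * k := by
    rw [card_freeSet hdisj, hn]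
    simp only [hcard, sum_const, card_univ, Fintype.card_fin, smul_eq_mul]
    omega
  have hfreeq : ((freeSet C).card : ℚ) = n - 4 * k := by
    rw [hfree, Nat.cast_sub (by have := mem_mul_le_card C hcard hdisj; rw [hn] at this; exact this), hn_def]
    push_cast
    ring
  refine hasFlow_of_typeWeights C (fun X hX => card_eq_of_mem_punctured_family hX) _ _ (W n k)
    (fun a c d => W_nonneg n hn5 k a c d) ?_ ?_
  · -- the rows
    intro X hX
    have hX' := mem_punctured_family.1 hX
    have ha : ∀ i, typ C X i ≤ 3 := by
      intro i
      have := typ_lt_card_of_not_subset C (hX'.2 i)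
      rw [hcard] at this
      omega
    have hs := sum_typ_add_fc hdisj X
    rw [hX'.1, sum_coords _ ha] at hs
    have hcnt := cnt_add _ ha
    have hfc : fc C X ≤ (freeSet C).card := fc_le_card C X
    have hkq : (cnt 1 (typ C X) : ℚ) + (cnt 2 (typ C X) : ℚ) + (cnt 3 (typ C X) : ℚ) ≤ k := by
      have : cnt 1 (typ C X) + cnt 2 (typ C X) + cnt 3 (typ C X) ≤ k := by omega
      exact_mod_cast this
    have hfq : (6 : ℚ) - (cnt 1 (typ C X)) - 2 * (cnt 2 (typ C X)) - 3 * (cnt 3 (typ C X)) ≤ n - 4 * k := by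
      have h1 : ((6 - cnt 1 (typ C X) - 2 * cnt 2 (typ C X) - 3 * cnt 3 (typ C X) : ℕ) : ℚ) =
          (6 : ℚ) - (cnt 1 (typ C X)) - 2 * (cnt 2 (typ C X)) - 3 * (cnt 3 (typ C X)) := by
        rw [Nat.cast_sub (by omega), Nat.cast_sub (by omega), Nat.cast_sub (by omega)]
        push_cast
        ring
      rw [← h1, ← hfreeq]
      have : 6 - cnt 1 (typ C X) - 2 * cnt 2 (typ C X) - 3 * cnt 3 (typ C X) ≤ (freeSet C).card := by omega
      exact_mod_cast this
    rw [rowSum_eq]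
    have e : ∀ i, (((C i \ X).card : ℕ) : ℚ) * W n k (typ C X) (fc C X) (some i) =
        (fun v => (((4 - v : ℕ) : ℚ) * (wdir n k (cnt 1 (typ C X)) (cnt 2 (typ C X)) (cnt 3 (typ C X)) v / Yc n))) (typ C X i) := by
      intro i
      rw [W_some, card_sdiff_eq_sub_typ, hcard]
    rw [sum_congr rfl (fun i _ => e i), sum_eq_cnt (typ C X) ha (fun v => (((4 - v : ℕ) : ℚ) * (wdir n k (cnt 1 (typ C X)) (cnt 2 (typ C X)) (cnt 3 (typ C X)) v / Yc n))),
      card_freeSet_sdiff, Nat.cast_sub hfc, hfreeq, W_none]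
    simp only [Nat.reduceSub, Nat.cast_ofNat, Nat.cast_one]
    have hc0 : (cnt 0 (typ C X) : ℚ) = k - ((cnt 1 (typ C X) : ℚ) + (cnt 2 (typ C X) : ℚ) + (cnt 3 (typ C X) : ℚ)) := by
      have : cnt 0 (typ C X) = k - (cnt 1 (typ C X) + cnt 2 (typ C X) + cnt 3 (typ C X)) := by omega
      rw [this, Nat.cast_sub (by omega)]
      push_cast
      ring
    have hcq : (fc C X : ℚ) = (6 : ℚ) - (cnt 1 (typ C X)) - 2 * (cnt 2 (typ C X)) - 3 * (cnt 3 (typ C X)) := by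
      have : fc C X = 6 - cnt 1 (typ C X) - 2 * cnt 2 (typ C X) - 3 * cnt 3 (typ C X) := by omega
      rw [this, Nat.cast_sub (by omega), Nat.cast_sub (by omega), Nat.cast_sub (by omega)]
      push_cast
      ring
    rw [hc0, wdir_top,
      wdir_eq_raw n k (cnt 1 (typ C X)) (cnt 2 (typ C X)) (cnt 3 (typ C X)) 0 (by norm_num) hn5 hk3 hkq hfq,
      wdir_eq_raw n k (cnt 1 (typ C X)) (cnt 2 (typ C X)) (cnt 3 (typ C X)) 1 (by norm_num) hn5 hk3 hkq hfq,
      wdir_eq_raw n k (cnt 1 (typ C X)) (cnt 2 (typ C X)) (cnt 3 (typ C X)) 2 (by norm_num) hn5 hk3 hkq hfq,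
      wdir_eq_raw n k (cnt 1 (typ C X)) (cnt 2 (typ C X)) (cnt 3 (typ C X)) 4 (by norm_num) hn5 hk3 hkq hfq,
      hcq]
    have key := row_check n k hQ hP hPc (cnt 1 (typ C X)) (cnt 2 (typ C X)) (cnt 3 (typ C X)) (by omega)
    rw [show (1 : ℚ) / Pc n k = (Yc n / Pc n k) / Yc n by field_simp, ← key]
    ring
  · -- the columns
    intro Y hY
    have hYc : Y.card = 6 + 1 := (mem_cols.1 hY).2
    by_cases hmem : ∃ i₀, C i₀ ⊆ Y
    · obtain ⟨i₀, hi₀⟩ := hmem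
      rw [colSum_eq_of_member (W n k) hdisj hbig hYc hi₀, hcard, W_some]
      have hi : typ C Y i₀ = 4 := by rw [typ_eq_card_of_subset C hi₀, hcard]
      rw [Function.update_self, hi, show (4 - 1 : ℕ) = 3 by norm_num, wdir_top, ← mul_div_assoc]
      norm_num
    · have hmem' : ∀ i, ¬ C i ⊆ Y := fun i h => hmem ⟨i, h⟩
      rw [colSum_eq_of_free (W n k) hdisj hYc hmem']
      have hb : ∀ i, typ C Y i ≤ 3 := by
        intro i
        have := typ_lt_card_of_not_subset C (hmem' i)
        rw [hcard] at this
        omega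
      have hs := sum_typ_add_fc hdisj Y
      rw [hYc, sum_coords _ hb] at hs
      have hcnt := cnt_add _ hb
      have hfc : fc C Y ≤ (freeSet C).card := fc_le_card C Y
      set d1 := cnt 1 (typ C Y) with hd1
      set d2 := cnt 2 (typ C Y) with hd2
      set d3 := cnt 3 (typ C Y) with hd3
      set c := fc C Y with hc
      have e : ∀ i, ((typ C Y i : ℕ) : ℚ) * W n k (Function.update (typ C Y) i (typ C Y i - 1)) c (some i) =
          (fun v => ((v : ℕ) : ℚ) * (if v = 1 then wdir n k (d1 - 1) d2 d3 0 / Yc n else if v = 2 then wdir n k (d1 + 1) (d2 - 1) d3 1 / Yc n else if v = 3 then wdir n k d1 (d2 + 1) (d3 - 1) 2 / Yc n else 0)) (typ C Y i) := by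
        intro i
        rw [W_some, Function.update_self]
        have h_1 := cnt_update 1 (typ C Y) i (typ C Y i - 1)
        have h_2 := cnt_update 2 (typ C Y) i (typ C Y i - 1)
        have h_3 := cnt_update 3 (typ C Y) i (typ C Y i - 1)
        rw [← hd1] at h_1
        rw [← hd2] at h_2
        rw [← hd3] at h_3
        have hi := hb i
        rcases Nat.lt_or_ge (typ C Y i) 1 with h0 | h0
        · have hu : typ C Y i = 0 := by omega
          rw [hu]
          simp
        rcases Nat.lt_or_ge (typ C Y i) 2 with h1 | h1
        · have hu : typ C Y i = 1 := by omega
          rw [hu] at h_1 h_2 h_3 ⊢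
          norm_num at h_1 h_2 h_3
          simp only [Nat.reduceSub]
          have e1 : cnt 1 (Function.update (typ C Y) i 0) = d1 - 1 := by omega
          have e2 : cnt 2 (Function.update (typ C Y) i 0) = d2 := by omega
          have e3 : cnt 3 (Function.update (typ C Y) i 0) = d3 := by omega
          rw [e1, e2, e3]
          simp
        rcases Nat.lt_or_ge (typ C Y i) 3 with h2 | h2
        · have hu : typ C Y i = 2 := by omega
          rw [hu] at h_1 h_2 h_3 ⊢
          norm_num at h_1 h_2 h_3
          simp only [Nat.reduceSub]
          have e1 : cnt 1 (Function.update (typ C Y) i 1) = d1 + 1 := by omega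
          have e2 : cnt 2 (Function.update (typ C Y) i 1) = d2 - 1 := by omega
          have e3 : cnt 3 (Function.update (typ C Y) i 1) = d3 := by omega
          rw [e1, e2, e3]
          simp
        · have hu : typ C Y i = 3 := by omega
          rw [hu] at h_1 h_2 h_3 ⊢
          norm_num at h_1 h_2 h_3
          simp only [Nat.reduceSub]
          have e1 : cnt 1 (Function.update (typ C Y) i 2) = d1 := by omega
          have e2 : cnt 2 (Function.update (typ C Y) i 2) = d2 + 1 := by omega
          have e3 : cnt 3 (Function.update (typ C Y) i 2) = d3 - 1 := by omega
          rw [e1, e2, e3]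
          simp
      rw [sum_congr rfl (fun i _ => e i), sum_eq_cnt (typ C Y) hb (fun v => ((v : ℕ) : ℚ) * (if v = 1 then wdir n k (d1 - 1) d2 d3 0 / Yc n else if v = 2 then wdir n k (d1 + 1) (d2 - 1) d3 1 / Yc n else if v = 3 then wdir n k d1 (d2 + 1) (d3 - 1) 2 / Yc n else 0)), W_none]
      simp only [Nat.cast_zero, zero_mul, Nat.cast_one, one_mul, Nat.cast_ofNat, if_true, if_false,
        Nat.reduceEqDiff]
      rw [← hd1, ← hd2, ← hd3]
      have hkq : (d1 : ℚ) + d2 + d3 ≤ k := by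
        have : d1 + d2 + d3 ≤ k := by omega
        exact_mod_cast this
      have hcq : (c : ℚ) = (7 : ℚ) - d1 - 2 * d2 - 3 * d3 := by
        have : c = 7 - d1 - 2 * d2 - 3 * d3 := by omega
        rw [this, Nat.cast_sub (by omega), Nat.cast_sub (by omega), Nat.cast_sub (by omega)]
        push_cast
        ring
      have hcle : (c : ℚ) ≤ n - 4 * k := by rw [← hfreeq]; exact_mod_cast hfc
      have t1 : (d1 : ℚ) * (wdir n k (d1 - 1) d2 d3 0 / Yc n) = (d1 : ℚ) * (raw n k (d1 - 1) d2 d3 0 / Yc n) := by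
        rcases Nat.eq_zero_or_pos d1 with h | h
        · rw [h]; simp
        · rw [wdir_eq_raw n k (d1 - 1) d2 d3 0 (by norm_num) hn5 hk3]
          · rw [Nat.cast_sub h]; push_cast; linarith
          · rw [Nat.cast_sub h]; push_cast; linarith
      have t2 : (d2 : ℚ) * (2 * (wdir n k (d1 + 1) (d2 - 1) d3 1 / Yc n)) = (d2 : ℚ) * (2 * (raw n k (d1 + 1) (d2 - 1) d3 1 / Yc n)) := by
        rcases Nat.eq_zero_or_pos d2 with h | h
        · rw [h]; simp
        · rw [wdir_eq_raw n k (d1 + 1) (d2 - 1) d3 1 (by norm_num) hn5 hk3]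
          · rw [Nat.cast_sub h]; push_cast; linarith
          · rw [Nat.cast_sub h]; push_cast; linarith
      have t3 : (d3 : ℚ) * (3 * (wdir n k d1 (d2 + 1) (d3 - 1) 2 / Yc n)) = (d3 : ℚ) * (3 * (raw n k d1 (d2 + 1) (d3 - 1) 2 / Yc n)) := by
        rcases Nat.eq_zero_or_pos d3 with h | h
        · rw [h]; simp
        · rw [wdir_eq_raw n k d1 (d2 + 1) (d3 - 1) 2 (by norm_num) hn5 hk3]
          · rw [Nat.cast_sub h]; push_cast; linarith
          · rw [Nat.cast_sub h]; push_cast; linarith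
      have tF : (c : ℚ) * (wdir n k d1 d2 d3 4 / Yc n) = (c : ℚ) * (raw n k d1 d2 d3 4 / Yc n) := by
        rcases Nat.eq_zero_or_pos c with h | h
        · rw [h]; simp
        · rw [wdir_eq_raw n k d1 d2 d3 4 (by norm_num) hn5 hk3 hkq]
          have : (1 : ℚ) ≤ c := by exact_mod_cast h
          linarith
      rw [t1, t2, t3, tF, hcq]
      have key := col_check n k hQ hP d1 d2 d3 (by omega)
      rw [show (1 : ℚ) / Yc n = (1 * (d1 : ℚ) * raw n k (d1 - 1) d2 d3 0 + 2 * (d2 : ℚ) * raw n k (d1 + 1) (d2 - 1) d3 1 + 3 * (d3 : ℚ) * raw n k d1 (d2 + 1) (d3 - 1) 2 + ((7 : ℚ) - d1 - 2 * d2 - 3 * d3) * raw n k d1 d2 d3 4) / Yc n by rw [key]]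
      ring

/-- **THEOREM. (SP) for ANY number of pairwise disjoint `4`-sets at level `6` on EVERY finite ground set.** -/
theorem puncturedNMP_allk_4_6 (C : Fin k → Finset α) (hcard : ∀ i, (C i).card = 4)
    (hdisj : ∀ i l, i ≠ l → Disjoint (C i) (C l)) :
    PuncturedNMP 6 ((univ : Finset (Fin k)).biUnion (fun i => upLevel 6 (C i))) := by
  rcases Nat.lt_or_ge (Fintype.card α) 7 with h | h
  · exact puncturedNMP_of_card_le _ (by omega)
  · obtain ⟨m', hm⟩ : ∃ m', Fintype.card α = m' + 7 := ⟨Fintype.card α - 7, by omega⟩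
    exact puncturedNMP_unif_of_le m' hm C hcard hdisj

end Main

end PercRepro.PuncturedLYM.Split.TypeLift.Unif46
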